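/-
Copyright (c) 2026 the pub-hodgecm-mathlib formalisation cell (harness21).  Prover seat hodgecm-mathlib-F0P3a-p01 (g16): road «S3-ram» (LEAD F0P3a-plan (g12); architect
A-p16 (g31) 23:50:49Z «JUNCTION = yours»), junction brick J4a «FIXED VERTICES ARE DEPTH-BOUNDED»; 2026-09-02.
-/
import Literature.NumberTheory.Automorphic.UnitaryLatticeTreeIsolatedIndexStableRoot   -- ★ p847183 (this seat): `pairing_diagonal_single_left`; brings ★ `UnitaryLatticeTreeTypes` ∕ `Dual` ∕ `Defs`
import Literature.NumberTheory.Automorphic.UnitaryLatticeTreeFixedVertex            -- ★ (F0P2-p01): `scaleLattice_mono`, `scaleLattice_scaleLattice`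
import Literature.NumberTheory.Automorphic.UnitaryLatticeTreeIntervalFinite         -- ★ J4b (F0P3-p03 (g15), p847325): `finite_of_forall_scaleLattice_le_and_le`
import HarnessLib

/-!
# The lattice graph of a hermitian space — a vertex lattice stable under a REGULAR diagonal element is squeezed between two fixed multiples of the root:
# `ϖδ·L₀ ≤ M ≤ δ⁻¹·L₀` (Kottwitz 1986 §3; Serre, *Trees* II.1.1; Bruhat–Tits 1972 §10)

Topic `NumberTheory/Automorphic`; namespace `Literature.NumberTheory.Automorphic.UnitaryLatticeTree`.  THEOREMS ONLY (no definition, no instance, no notation, no named fact,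
no `sorry`); kernel lane `--supports stmt-HodgeConjecture-24833`; datum-free (`K` with `Valued K ℤᵐ⁰`, `σ` valuation-preserving).  Cell `pub/hodgecm-mathlib` (D-0151), crux H413;
road «S3-ram», P-1-ram organ A′ (ii) (a2), JUNCTION brick **J4a** of the plan `STATUS 23:57:42Z`: the engine ★ `strataVec_cone_eq_of_localLaw` (G5, p847302) needs the fixed
vertex set `F = Fix T` to be FINITE; this file gives the DEPTH BOUND (every fixed vertex lies between `ϖδ·L₀` and `δ⁻¹·L₀` for an explicit `δ ≠ 0` depending only on `T`), and
J4b («lattice intervals are finite» for a finite residue field) turns it into `F.Finite`.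

THE MATHEMATICS (the literal's DIAGONAL eigenframe: form `H = diag(d)` with UNIT entries, element `T = diag(λ₀, λ₁, λ₂)` with INTEGRAL, pairwise DISTINCT entries).  Let
`δ_i = Π_{j ≠ i}(λ_i − λ_j)` and let `δ ≠ 0` with `|δ| ≤ |δ_i|` for all `i`.  (§1, Lagrange interpolation in `𝒪[T]` with the denominators KEPT — the unit-denominator version is ★
`smul_sub_mem_of_map_diagonal_le`): if `T·M ⊆ M` then `(T − λ_j)(T − λ_k)x = δ_i·x_i·e_i ∈ M` for every `x ∈ M` (`{i,j,k} = {0,1,2}`).  (§2) If moreover `M ≤ M^♯` (every vertex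
lattice, ★ `le_dualLatt_of_isVertexLattice`) then `|⟨δ_i x_i e_i, x⟩| = |δ_i|·|x_i|² ≤ 1`, whence `|δ_i x_i| ≤ 1` and `M ≤ δ⁻¹·L₀`.  (§3) If moreover `ϖ·M^♯ ≤ M` (every vertex
lattice, ★ `scaleLattice_dualLatt_le_of_isVertexLattice`) then `δ·L₀ ≤ (δ⁻¹·L₀)^♯ ≤ M^♯` (`|⟨x, y⟩| ≤ max_i |x_i||d_i||y_i| ≤ |δ|⁻¹·|δ|`), so `ϖδ·L₀ ≤ M`.  (§4) Hence every
`T`-fixed vertex of `latticeGraph σ ϖ (diag d)` lies in the INTERVAL `[ϖδ·L₀, δ⁻¹·L₀]` — for the ramified type-(1) literal `T = diag(α, u, γ)` one may take `δ = ϖ^{2·max(N₁,N₂,N)}`.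
HONEST LABEL: HC_CM is proved only modulo the 2 remaining named inputs (hLiu418 24832, h413 24833) until rung 0 closes; nothing printed is asserted here (elementary lattice algebra).

## References
* [Kottwitz1986] R. E. Kottwitz, *Base change for unit elements of Hecke algebras*, Compositio Math. 60 (1986), §3 (fixed lattices are modules over the order `𝒪[γ]`, finitely many).
* [Serre1980Trees] J.-P. Serre, *Trees* (1980), Ch. II §1.1 (lattices stable under a split semisimple element lie in a bounded strip of its apartment).
* [BruhatTits1972] F. Bruhat, J. Tits, *Groupes réductifs sur un corps local I*, Publ. Math. IHÉS 41 (1972), §10.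
-/

set_option autoImplicit false

noncomputable section

open scoped Valued WithZero Matrix MatrixGroups

namespace Literature.NumberTheory.Automorphic.UnitaryLatticeTree

open Literature.NumberTheory.Automorphic Literature.NumberTheory.Automorphic.HermitianLattice

variable {K : Type*} [Field K] [Valued K ℤᵐ⁰]

/-! ## §1 Lagrange interpolation with the denominators kept -/

/-- One step: if `M` is stable under `diag(s)` (`|s_l| ≤ 1`) then `x ∈ M ⇒ ((s_l − s_j)·x_l)_l ∈ M`. [cite: Kottwitz1986, §3] -/
theorem sub_mul_apply_mem_of_map_diagonal_le {N : ℕ} {s : Fin N → K} (hs : ∀ l, Valued.v (s l) ≤ 1)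
    {M : Submodule 𝒪[K] (Fin N → K)} (hSM : M.map ((Matrix.toLin' (Matrix.diagonal s)).restrictScalars 𝒪[K]) ≤ M)
    (j : Fin N) {x : Fin N → K} (hx : x ∈ M) : (fun l => (s l - s j) * x l) ∈ M := by
  have hsx : (fun l => s l * x l) ∈ M := by
    have h := hSM (Submodule.mem_map.2 ⟨x, hx, rfl⟩)
    rw [LinearMap.restrictScalars_apply, Matrix.toLin'_apply, show Matrix.diagonal s *ᵥ x = fun l => s l * x l from funext (Matrix.mulVec_diagonal s x)] at h
    exact h
  have hjx : (⟨s j, hs j⟩ : 𝒪[K]) • x ∈ M := M.smul_mem _ hx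
  have heq : (fun l => (s l - s j) * x l) = (fun l => s l * x l) - (⟨s j, hs j⟩ : 𝒪[K]) • x := by
    funext l
    simp only [Pi.sub_apply, Pi.smul_apply, sub_mul]
    rfl
  rw [heq]
  exact M.sub_mem hsx hjx

/-- **Two steps (`N = 3`)**: for `{i, j, k} = {0, 1, 2}` and `x ∈ M` stable under `diag(s)`, the vector `δ_i·x_i·e_i` with `δ_i = (s_i − s_j)(s_i − s_k)` lies in `M`.
[cite: Kottwitz1986, §3] [cite: Serre1980Trees, II.1.1] -/
theorem single_mul_mul_apply_mem_of_map_diagonal_le {s : Fin 3 → K} (hs : ∀ l, Valued.v (s l) ≤ 1)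
    {M : Submodule 𝒪[K] (Fin 3 → K)} (hSM : M.map ((Matrix.toLin' (Matrix.diagonal s)).restrictScalars 𝒪[K]) ≤ M)
    {i j k : Fin 3} (hij : i ≠ j) (hik : i ≠ k) (hjk : j ≠ k) {x : Fin 3 → K} (hx : x ∈ M) :
    (Pi.single i ((s i - s j) * (s i - s k) * x i) : Fin 3 → K) ∈ M := by
  have h2 := sub_mul_apply_mem_of_map_diagonal_le hs hSM j (sub_mul_apply_mem_of_map_diagonal_le hs hSM k hx)
  have heq : (Pi.single i ((s i - s j) * (s i - s k) * x i) : Fin 3 → K) = fun l => (s l - s j) * ((s l - s k) * x l) := by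
    funext l
    by_cases hl : l = i
    · subst hl; rw [Pi.single_eq_same, mul_assoc]
    · rw [Pi.single_eq_of_ne hl]
      -- `l ∈ {j, k}`
      have hljk : l = j ∨ l = k := by
        by_contra hcon
        push Not at hcon
        have h1 := Fin.val_ne_of_ne hij; have h2 := Fin.val_ne_of_ne hik; have h3 := Fin.val_ne_of_ne hjk
        have h4 := Fin.val_ne_of_ne hl; have h5 := Fin.val_ne_of_ne hcon.1; have h6 := Fin.val_ne_of_ne hcon.2
        have := i.isLt; have := j.isLt; have := k.isLt; have := l.isLt
        omega
      rcases hljk with rfl | rfl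
      · rw [sub_self, zero_mul]
      · rw [sub_self, zero_mul, mul_zero]
  rw [heq]
  exact h2

/-! ## §2 The upper bound `M ≤ δ⁻¹·L₀` from `M ≤ M^♯` -/

/-- `a·a ≤ 1 ⇒ a ≤ 1` in the value group. [folklore] -/
private theorem le_one_of_mul_self_le_one {a : ℤᵐ⁰} (h : a * a ≤ 1) : a ≤ 1 := by
  rcases le_or_gt a 1 with ha | ha
  · exact ha
  · exact absurd h (not_le.2 (lt_of_lt_of_le ha (le_mul_of_one_le_right' ha.le)))

/-- **THE UPPER BOUND**: for `H = diag(d)` with unit entries and `T = diag(s)` integral, if `M` is `T`-stable and `M ≤ M^♯` then `|δ_i·x_i| ≤ 1` for every `x ∈ M`, where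
`δ_i = (s_i − s_j)(s_i − s_k)`: the pairing of `δ_i x_i e_i ∈ M` (§1) with `x` is `σ(δ_i x_i)·d_i·x_i`. [cite: Kottwitz1986, §3] [cite: Serre1980Trees, II.1.1] -/
theorem v_mul_apply_le_one_of_map_diagonal_le_of_le_dualLatt {σ : K →+* K} (hvσ : ∀ a, Valued.v (σ a) = Valued.v a) {d : Fin 3 → K} (hd : ∀ i, Valued.v (d i) = 1)
    {s : Fin 3 → K} (hs : ∀ l, Valued.v (s l) ≤ 1)
    {M : Submodule 𝒪[K] (Fin 3 → K)} (hSM : M.map ((Matrix.toLin' (Matrix.diagonal s)).restrictScalars 𝒪[K]) ≤ M) (hMd : M ≤ dualLatt σ (Matrix.diagonal d) M)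
    {i j k : Fin 3} (hij : i ≠ j) (hik : i ≠ k) (hjk : j ≠ k) {x : Fin 3 → K} (hx : x ∈ M) :
    Valued.v ((s i - s j) * (s i - s k) * x i) ≤ 1 := by
  have hy := single_mul_mul_apply_mem_of_map_diagonal_le hs hSM hij hik hjk hx
  have hpair := (mem_dualLatt σ (Matrix.diagonal d) M x).1 (hMd hx) _ hy
  rw [pairing_diagonal_single_left, map_mul, map_mul, hvσ, hd, mul_one] at hpair
  -- `|δ_i x_i| · |x_i| ≤ 1` and `|δ_i| ≤ 1` give `|δ_i x_i|² ≤ 1`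
  have hδ : Valued.v ((s i - s j) * (s i - s k)) ≤ 1 := by
    rw [map_mul]
    have h1 : Valued.v (s i - s j) ≤ 1 := (Valuation.map_sub _ _ _).trans (max_le (hs i) (hs j))
    have h2 : Valued.v (s i - s k) ≤ 1 := (Valuation.map_sub _ _ _).trans (max_le (hs i) (hs k))
    exact mul_le_one' h1 h2
  refine le_one_of_mul_self_le_one ?_
  have ha : Valued.v ((s i - s j) * (s i - s k) * x i) = Valued.v ((s i - s j) * (s i - s k)) * Valued.v (x i) := map_mul _ _ _
  calc Valued.v ((s i - s j) * (s i - s k) * x i) * Valued.v ((s i - s j) * (s i - s k) * x i)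
      = Valued.v ((s i - s j) * (s i - s k)) * (Valued.v ((s i - s j) * (s i - s k) * x i) * Valued.v (x i)) := by
        rw [ha]; ac_rfl
    _ ≤ 1 * 1 := mul_le_mul' hδ hpair
    _ = 1 := one_mul 1

/-- **`M ≤ δ⁻¹·L₀`**: under the hypotheses of `v_mul_apply_le_one_of_map_diagonal_le_of_le_dualLatt`, for any `δ ≠ 0` with `|δ| ≤ |(s_i − s_j)(s_i − s_k)|` for all
orderings, `M ≤ scaleLattice δ⁻¹ L₀`. [cite: Kottwitz1986, §3] [cite: Serre1980Trees, II.1.1] -/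
theorem le_scaleLattice_inv_of_map_diagonal_le_of_le_dualLatt {σ : K →+* K} (hvσ : ∀ a, Valued.v (σ a) = Valued.v a) {d : Fin 3 → K} (hd : ∀ i, Valued.v (d i) = 1)
    {s : Fin 3 → K} (hs : ∀ l, Valued.v (s l) ≤ 1) {δ : K} (hδ0 : δ ≠ 0)
    (hδ : ∀ i j k : Fin 3, i ≠ j → i ≠ k → j ≠ k → Valued.v δ ≤ Valued.v ((s i - s j) * (s i - s k)))
    {M : Submodule 𝒪[K] (Fin 3 → K)} (hSM : M.map ((Matrix.toLin' (Matrix.diagonal s)).restrictScalars 𝒪[K]) ≤ M) (hMd : M ≤ dualLatt σ (Matrix.diagonal d) M) :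
    M ≤ scaleLattice δ⁻¹ (stdLattice K 3) := by
  intro x hx
  rw [mem_scaleLattice_stdLattice_iff (inv_ne_zero hδ0)]
  intro i
  -- choose `j, k` with `{i, j, k} = {0, 1, 2}`
  obtain ⟨j, k, hij, hik, hjk⟩ : ∃ j k : Fin 3, i ≠ j ∧ i ≠ k ∧ j ≠ k := by
    fin_cases i
    · exact ⟨1, 2, by decide, by decide, by decide⟩
    · exact ⟨0, 2, by decide, by decide, by decide⟩
    · exact ⟨0, 1, by decide, by decide, by decide⟩
  have h := v_mul_apply_le_one_of_map_diagonal_le_of_le_dualLatt hvσ hd hs hSM hMd hij hik hjk hx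
  have hvδ : Valued.v δ ≠ 0 := (Valuation.ne_zero_iff _).2 hδ0
  have key : Valued.v δ * Valued.v (x i) ≤ 1 :=
    calc Valued.v δ * Valued.v (x i) ≤ Valued.v ((s i - s j) * (s i - s k)) * Valued.v (x i) := mul_le_mul' (hδ i j k hij hik hjk) le_rfl
      _ = Valued.v ((s i - s j) * (s i - s k) * x i) := (map_mul _ _ _).symm
      _ ≤ 1 := h
  rw [map_inv₀]
  calc Valued.v (x i) = (Valued.v δ)⁻¹ * (Valued.v δ * Valued.v (x i)) := by rw [← mul_assoc, inv_mul_cancel₀ hvδ, one_mul]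
    _ ≤ (Valued.v δ)⁻¹ * 1 := mul_le_mul' le_rfl key
    _ = (Valued.v δ)⁻¹ := mul_one _


/-! ## §3 The lower bound `ϖδ·L₀ ≤ M` from `ϖ·M^♯ ≤ M` -/

/-- **`δ·L₀ ≤ (δ⁻¹·L₀)^♯ ≤ M^♯`** for the diagonal unit form: if `M ≤ δ⁻¹·L₀` then every `y` with `|y_i| ≤ |δ|` pairs integrally with `M` (`|⟨x, y⟩| ≤ max_i |x_i|·|d_i|·|y_i| ≤ 1`).
[cite: Jacobowitz1962, §4] [cite: Kottwitz1986, §3] -/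
theorem scaleLattice_le_dualLatt_of_le_scaleLattice_inv {σ : K →+* K} (hvσ : ∀ a, Valued.v (σ a) = Valued.v a) {d : Fin 3 → K} (hd : ∀ i, Valued.v (d i) = 1)
    {δ : K} (hδ0 : δ ≠ 0) {M : Submodule 𝒪[K] (Fin 3 → K)} (hM : M ≤ scaleLattice δ⁻¹ (stdLattice K 3)) :
    scaleLattice δ (stdLattice K 3) ≤ dualLatt σ (Matrix.diagonal d) M := by
  intro y hy
  rw [mem_dualLatt]
  intro x hx
  have hxi : ∀ i, Valued.v (x i) ≤ Valued.v δ⁻¹ := (mem_scaleLattice_stdLattice_iff (inv_ne_zero hδ0) x).1 (hM hx)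
  have hyi : ∀ i, Valued.v (y i) ≤ Valued.v δ := (mem_scaleLattice_stdLattice_iff hδ0 y).1 hy
  have hvδ : Valued.v δ ≠ 0 := (Valuation.ne_zero_iff _).2 hδ0
  rw [pairing_apply]
  refine Valuation.map_sum_le _ (fun i _ => Valuation.map_sum_le _ (fun j _ => ?_))
  by_cases hij : i = j
  · subst hij
    rw [Matrix.diagonal_apply_eq, map_mul, map_mul, hvσ, hd, mul_one]
    calc Valued.v (x i) * Valued.v (y i) ≤ Valued.v δ⁻¹ * Valued.v δ := mul_le_mul' (hxi i) (hyi i)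
      _ = 1 := by rw [map_inv₀, inv_mul_cancel₀ hvδ]
  · rw [Matrix.diagonal_apply_ne _ hij, mul_zero, zero_mul, map_zero]
    exact zero_le

/-- **THE LOWER BOUND**: for a VERTEX lattice `M` (so `ϖ·M^♯ ≤ M`, ★ `scaleLattice_dualLatt_le_of_isVertexLattice`) with `M ≤ δ⁻¹·L₀`: `ϖδ·L₀ ≤ M`.
[cite: Kottwitz1986, §3] [cite: BruhatTits1972, §10] -/
theorem scaleLattice_mul_le_of_isVertexLattice_of_le_scaleLattice_inv {σ : K →+* K} (hvσ : ∀ a, Valued.v (σ a) = Valued.v a) {ϖ : K} {d : Fin 3 → K}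
    (hd : ∀ i, Valued.v (d i) = 1) {δ : K} (hδ0 : δ ≠ 0) {dd : ℕ} {M : Submodule 𝒪[K] (Fin 3 → K)} (hMv : IsVertexLattice σ ϖ (Matrix.diagonal d) dd M)
    (hM : M ≤ scaleLattice δ⁻¹ (stdLattice K 3)) :
    scaleLattice (ϖ * δ) (stdLattice K 3) ≤ M := by
  have hH : IsUnit (Matrix.diagonal d).det := by
    rw [Matrix.det_diagonal, isUnit_iff_ne_zero]
    exact Finset.prod_ne_zero_iff.2 (fun i _ h0 => by have := hd i; rw [h0, map_zero] at this; exact zero_ne_one this)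
  calc scaleLattice (ϖ * δ) (stdLattice K 3) = scaleLattice ϖ (scaleLattice δ (stdLattice K 3)) := (scaleLattice_scaleLattice ϖ δ _).symm
    _ ≤ scaleLattice ϖ (dualLatt σ (Matrix.diagonal d) M) := scaleLattice_mono ϖ (scaleLattice_le_dualLatt_of_le_scaleLattice_inv hvσ hd hδ0 hM)
    _ ≤ M := scaleLattice_dualLatt_le_of_isVertexLattice hvσ hH hMv

/-! ## §4 Every fixed vertex lies in the interval `[ϖδ·L₀, δ⁻¹·L₀]` -/

/-- **A VERTEX FIXED BY A REGULAR DIAGONAL ELEMENT IS DEPTH-BOUNDED**: for the diagonal unit form `H = diag(d)` and `T = diag(s)` integral with pairwise distinct entries, any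
`δ ≠ 0` with `|δ| ≤ |(s_i − s_j)(s_i − s_k)|` for all orderings, and any VERTEX `M` of `latticeGraph σ ϖ H` with `T·M = M`: `ϖδ·L₀ ≤ M ≤ δ⁻¹·L₀`.  With J4b («lattice intervals
are finite») this is the finiteness of the fixed vertex set `Fix T` that the G5 engine needs; for the ramified type-(1) literal `diag(α, u, γ)` take `δ = ϖ^{2·max(N₁, N₂, N)}`.
[cite: Kottwitz1986, §3] [cite: Serre1980Trees, II.1.1] [cite: BruhatTits1972, §10] -/
theorem scaleLattice_le_and_le_scaleLattice_of_isVertex_of_mapGL_diagonal_eq {σ : K →+* K} (hvσ : ∀ a, Valued.v (σ a) = Valued.v a) {ϖ : K} {d : Fin 3 → K}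
    (hd : ∀ i, Valued.v (d i) = 1) {s : Fin 3 → K} (hs : ∀ l, Valued.v (s l) ≤ 1) {δ : K} (hδ0 : δ ≠ 0)
    (hδ : ∀ i j k : Fin 3, i ≠ j → i ≠ k → j ≠ k → Valued.v δ ≤ Valued.v ((s i - s j) * (s i - s k)))
    (T : GL (Fin 3) K) (hT : (T : Matrix (Fin 3) (Fin 3) K) = Matrix.diagonal s)
    {M : Submodule 𝒪[K] (Fin 3 → K)} (hM : IsVertex σ ϖ (Matrix.diagonal d) M) (hfix : mapGL T M = M) :
    scaleLattice (ϖ * δ) (stdLattice K 3) ≤ M ∧ M ≤ scaleLattice δ⁻¹ (stdLattice K 3) := by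
  obtain ⟨dd, hMv⟩ := hM
  have hSM : M.map ((Matrix.toLin' (Matrix.diagonal s)).restrictScalars 𝒪[K]) ≤ M := by
    rw [← hT]; exact hfix.le
  have hup := le_scaleLattice_inv_of_map_diagonal_le_of_le_dualLatt hvσ hd hs hδ0 hδ hSM (le_dualLatt_of_isVertexLattice hvσ hMv)
  exact ⟨scaleLattice_mul_le_of_isVertexLattice_of_le_scaleLattice_inv hvσ hd hδ0 hMv hup, hup⟩

/-- The same for the vertices of the graph fixed by the graph automorphism of a UNITARY diagonal `T` (★ `latticeGraphIso`): the fixed set is contained in the interval.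
[cite: Kottwitz1986, §3] [cite: Serre1980Trees, II.1.1] -/
theorem setOf_latticeGraphIso_eq_subset_interval {σ : K →+* K} (hvσ : ∀ a, Valued.v (σ a) = Valued.v a) {ϖ : K} {d : Fin 3 → K}
    (hd : ∀ i, Valued.v (d i) = 1) {s : Fin 3 → K} (hs : ∀ l, Valued.v (s l) ≤ 1) {δ : K} (hδ0 : δ ≠ 0)
    (hδ : ∀ i j k : Fin 3, i ≠ j → i ≠ k → j ≠ k → Valued.v δ ≤ Valued.v ((s i - s j) * (s i - s k)))
    (T : unitaryGroupOfForm σ (Matrix.diagonal d)) (hT : ((T : GL (Fin 3) K) : Matrix (Fin 3) (Fin 3) K) = Matrix.diagonal s) :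
    {v : {M : Submodule 𝒪[K] (Fin 3 → K) // IsVertex σ ϖ (Matrix.diagonal d) M} | latticeGraphIso σ ϖ (Matrix.diagonal d) T v = v} ⊆
      {v | scaleLattice (ϖ * δ) (stdLattice K 3) ≤ v.1 ∧ v.1 ≤ scaleLattice δ⁻¹ (stdLattice K 3)} := by
  intro v hv
  have hfix : mapGL (T : GL (Fin 3) K) v.1 = v.1 := by
    have h := congrArg Subtype.val hv
    exact h
  exact scaleLattice_le_and_le_scaleLattice_of_isVertex_of_mapGL_diagonal_eq hvσ hd hs hδ0 hδ (T : GL (Fin 3) K) hT v.2 hfix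


/-! ## §5 Finiteness of the fixed vertex set (with ★ J4b `finite_of_forall_scaleLattice_le_and_le`) -/

/-- **THE FIXED VERTEX SET OF A REGULAR DIAGONAL UNITARY ELEMENT IS FINITE** (finite residue field): §4 puts it inside the lattice interval `[ϖδ·L₀, δ⁻¹·L₀]`, which is finite by
★ J4b.  This is the hypothesis `hFfin` of the G5 engine ★ `strataVec_cone_eq_of_localLaw` for `F = Fix T`. [cite: Kottwitz1986, §3] [cite: Serre1980Trees, II.1.1] -/
theorem finite_setOf_latticeGraphIso_diagonal_eq [Finite 𝓀[K]] {σ : K →+* K} (hvσ : ∀ a, Valued.v (σ a) = Valued.v a) {ϖ : K}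
    (hϖ : Valued.v ϖ = WithZero.exp (-1 : ℤ)) {d : Fin 3 → K}
    (hd : ∀ i, Valued.v (d i) = 1) {s : Fin 3 → K} (hs : ∀ l, Valued.v (s l) ≤ 1) {δ : K} (hδ0 : δ ≠ 0)
    (hδ : ∀ i j k : Fin 3, i ≠ j → i ≠ k → j ≠ k → Valued.v δ ≤ Valued.v ((s i - s j) * (s i - s k)))
    (T : unitaryGroupOfForm σ (Matrix.diagonal d)) (hT : ((T : GL (Fin 3) K) : Matrix (Fin 3) (Fin 3) K) = Matrix.diagonal s) :
    {v : {M : Submodule 𝒪[K] (Fin 3 → K) // IsVertex σ ϖ (Matrix.diagonal d) M} | latticeGraphIso σ ϖ (Matrix.diagonal d) T v = v}.Finite := by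
  have hϖ0 : ϖ ≠ 0 := by
    intro h; rw [h, map_zero] at hϖ; exact WithZero.coe_ne_zero hϖ.symm
  have hϖ1 : Valued.v ϖ ≤ 1 := by rw [hϖ, ← WithZero.exp_zero]; exact WithZero.exp_le_exp.2 (by norm_num)
  -- `|δ| ≤ 1`, hence `|ϖδ| ≤ |δ⁻¹|`
  have hδ1 : Valued.v δ ≤ 1 := by
    refine (hδ 0 1 2 (by decide) (by decide) (by decide)).trans ?_
    rw [map_mul]
    exact mul_le_one' ((Valuation.map_sub _ _ _).trans (max_le (hs 0) (hs 1))) ((Valuation.map_sub _ _ _).trans (max_le (hs 0) (hs 2)))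
  have hab : Valued.v (ϖ * δ) ≤ Valued.v δ⁻¹ := by
    rw [map_mul, map_inv₀]
    calc Valued.v ϖ * Valued.v δ ≤ 1 * 1 := mul_le_mul' hϖ1 hδ1
      _ = 1 := one_mul 1
      _ ≤ (Valued.v δ)⁻¹ := one_le_inv_iff₀.2 ⟨(Valuation.pos_iff _).2 hδ0, hδ1⟩
  have himage : (Subtype.val '' {v : {M : Submodule 𝒪[K] (Fin 3 → K) // IsVertex σ ϖ (Matrix.diagonal d) M} |
      latticeGraphIso σ ϖ (Matrix.diagonal d) T v = v}).Finite := by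
    refine finite_of_forall_scaleLattice_le_and_le hϖ (mul_ne_zero hϖ0 hδ0) hab (fun M hM => ?_)
    obtain ⟨v, hv, rfl⟩ := hM
    exact setOf_latticeGraphIso_eq_subset_interval hvσ hd hs hδ0 hδ T hT hv
  exact Set.Finite.of_finite_image himage Subtype.val_injective.injOn

end Literature.NumberTheory.Automorphic.UnitaryLatticeTree
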